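import Summits.Ventures.CertifiedManyBodySolver.Theorems.TcThermcert1FreeCanonicalFugacityPullThroughCreation
import HarnessLib

/-!
# Free canonical gas at `β·t = 8` — localisation of the two-leg pull-through on the support of the insertion

Helper file for route `TcThermcert1` (crux K1′ `ThermalStiffnessCeilingU8b8_le_7o44`, item `stmt-Ventures-24560`), crux idea
`free-canonical-b8-rung`; continuation of `Theorems/TcThermcert1FreeCanonicalFugacityPullThroughCreation.lean`.

For an EVEN observable `A` supported on `orbSet X`:
* `[c_{yσ}, A] = 0` for `y ∉ X` (tree: `commutator_eq_zero_of_not_mem`);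
* `{[c_{yσ}, A], c†_{kτ}} = 0` for `k ∉ X` and `(k,τ) ≠ (y,σ)` (§1: `c†_k` commutes with `A` and anticommutes with `c_y`; no parity
  calculus needed);
* hence the double sum of `fugacity_pullThrough_current_twoLeg` LOCALISES to `y, k ∈ X` (§2):
  `T(A j_σ) = i Σ_{y∈X} Σ_{k∈X} (G_ζ(a,y)G''(b,k) − G_ζ(b,y)G''(a,k)) · T({[c_{yσ},A], c†_{kσ}})` — `|X|²` terms —
* and each insertion has norm `‖{[c_{yσ},A], c†_{kσ}}‖ ≤ 4‖A‖` (§3).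
So `|T(A j_σ)| ≤ 8 |X|² · max_{y∈X}|G_ζ(bond,y)| · max_{k∈X}|G''(bond,k)| · ‖A‖ · max |T(B'')|/‖B''‖`: the current is pulled into `X` at the
cost of two decaying kernels (S4, open) and one even insertion in `CAR(X)` (S6, open).

HONEST LABEL: finite-dimensional CAR algebra; a step of a RUNG (`U = 0`, BC5-type witness for the C8 bet), reach at `U = 8` ZERO; decides
nothing about K1/K1′/`T_c`; superconductivity in the Hubbard model is NOT proved or advanced by this file beyond the rung.
-/

noncomputable section

namespace Summit.Ventures.CertifiedManyBodySolver.Theorems.TcThermcert1.FreeCanonicalB8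

open NormedSpace Matrix Finset
open Literature.MathematicalPhysics.QuantumLattice
open Summit.Ventures.CertifiedManyBodySolver.Theorems.TcThermcert1.FreeGasCurrentClustering
open scoped Matrix.Norms.L2Operator ComplexOrder

variable {Λ : Type*} [LinearOrder Λ] [Fintype Λ]

/-! ## §1 The second-leg localisation: `{[c_{yσ}, A], c†_{kτ}} = 0` off the support -/

/-- For an even `A` on `orbSet X`, `k ∉ X` and `(k,τ) ≠ (y,σ)`: `{[c_{yσ},A], c†_{kτ}} = 0`. -/
theorem anticommutator_commutator_creation_eq_zero {X : Finset Λ} {A : Matrix (Finset (Orb Λ)) (Finset (Orb Λ)) ℂ}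
    (hA : A ∈ carEvenSubalgebra (orbSet X)) {y k : Λ} {σ τ : Fin 2} (hk : k ∉ X) (hne : orb y σ ≠ orb k τ) :
    (annihilation (orb y σ) * A - A * annihilation (orb y σ)) * creation (orb k τ) +
        creation (orb k τ) * (annihilation (orb y σ) * A - A * annihilation (orb y σ)) = 0 := by
  -- `c†_k` commutes with `A`
  have hdisj : Disjoint (orbSet X) ({orb k τ} : Finset (Orb Λ)) := by
    rw [Finset.disjoint_singleton_right, mem_orbSet]
    exact hk
  have hc : A * creation (orb k τ) = creation (orb k τ) * A :=
    (commute_of_mem_carEvenSubalgebra hA (creation_mem_carSubalgebra (Finset.mem_singleton_self (orb k τ))) hdisj).eq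
  -- `c_y` anticommutes with `c†_k`
  have ha : annihilation (orb y σ) * creation (orb k τ) = -(creation (orb k τ) * annihilation (orb y σ)) := by
    have h := annihilation_mul_creation_add_creation_mul_annihilation_holds (orb y σ) (orb k τ)
    rw [if_neg hne] at h
    exact eq_neg_of_add_eq_zero_left h
  have e1 : annihilation (orb y σ) * A * creation (orb k τ) = -(creation (orb k τ) * (annihilation (orb y σ) * A)) := by
    rw [Matrix.mul_assoc, hc, ← Matrix.mul_assoc, ha, Matrix.neg_mul, Matrix.mul_assoc]
  have e2 : A * annihilation (orb y σ) * creation (orb k τ) = -(creation (orb k τ) * (A * annihilation (orb y σ))) := by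
    rw [Matrix.mul_assoc, ha, Matrix.mul_neg, ← Matrix.mul_assoc, hc, Matrix.mul_assoc]
  rw [Matrix.sub_mul, Matrix.mul_sub, e1, e2]
  abel

/-! ## §2 The localised two-leg identity -/

/-- **Two-leg pull-through, localised on `supp A`.** Under the hypotheses of `fugacity_pullThrough_current_twoLeg`, for an EVEN
observable `A ∈ CAR(orbSet X)`:
`T(A j_σ) = i Σ_{y∈X} Σ_{k∈X} (G_ζ(a,y)G''(b,k) − G_ζ(b,y)G''(a,k)) · T({[c_{yσ},A], c†_{kσ}})`. -/
theorem fugacity_pullThrough_current_twoLeg_local (β : ℝ) (h : Matrix (Orb Λ) (Orb Λ) ℂ)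
    (hE : ∀ q k : Orb Λ, (ofLex q).2 ≠ (ofLex k).2 → (exp (-((β : ℂ) • h))) q k = 0) (σ : Fin 2)
    (D : Matrix (Finset (Orb Λ)) (Finset (Orb Λ)) ℂ) (ζ : ℂ)
    (hD : ∀ x : Λ, (ζ • D) * annihilation (orb x σ) = annihilation (orb x σ) * D)
    (hD' : ∀ x : Λ, D * creation (orb x σ) = ζ • (creation (orb x σ) * D))
    (Eσ : Matrix Λ Λ ℂ) (hEσ : ∀ x y : Λ, Eσ x y = (exp (-((β : ℂ) • h))) (orb x σ) (orb y σ))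
    (G' : Matrix Λ Λ ℂ) (hG' : G' * (1 + ζ • Eσ) = 1) (G'' : Matrix Λ Λ ℂ) (hG'' : G'' * (1 + ζ • Eσᵀ) = 1)
    {X : Finset Λ} {A : Matrix (Finset (Orb Λ)) (Finset (Orb Λ)) ℂ} (hA : A ∈ carEvenSubalgebra (orbSet X)) (a b : Λ)
    (hsymm : (ζ • (G' * Eσ)) a b = (ζ • (G' * Eσ)) b a) :
    (D * gibbsWeight β (dGamma h) *
        (A * ((-Complex.I) • (creation (orb a σ) * annihilation (orb b σ)) + Complex.I • (creation (orb b σ) * annihilation (orb a σ))))).trace =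
      Complex.I * ∑ y ∈ X, ∑ k ∈ X, ((ζ • (G' * Eσ)) a y * G'' b k - (ζ • (G' * Eσ)) b y * G'' a k) *
        (D * gibbsWeight β (dGamma h) *
          ((annihilation (orb y σ) * A - A * annihilation (orb y σ)) * creation (orb k σ) +
            creation (orb k σ) * (annihilation (orb y σ) * A - A * annihilation (orb y σ)))).trace := by
  rw [fugacity_pullThrough_current_twoLeg β h hE σ D ζ hD hD' Eσ hEσ G' hG' G'' hG'' A a b hsymm]
  congr 1
  symm
  -- extend the inner sum from `X` to `Λ` (terms with `k ∉ X` vanish), then the outer one (terms with `y ∉ X` vanish)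
  have hinner : ∀ y : Λ, y ∈ X →
      ∑ k ∈ X, ((ζ • (G' * Eσ)) a y * G'' b k - (ζ • (G' * Eσ)) b y * G'' a k) *
          (D * gibbsWeight β (dGamma h) *
            ((annihilation (orb y σ) * A - A * annihilation (orb y σ)) * creation (orb k σ) +
              creation (orb k σ) * (annihilation (orb y σ) * A - A * annihilation (orb y σ)))).trace =
        ∑ k : Λ, ((ζ • (G' * Eσ)) a y * G'' b k - (ζ • (G' * Eσ)) b y * G'' a k) *
          (D * gibbsWeight β (dGamma h) *
            ((annihilation (orb y σ) * A - A * annihilation (orb y σ)) * creation (orb k σ) +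
              creation (orb k σ) * (annihilation (orb y σ) * A - A * annihilation (orb y σ)))).trace := by
    intro y hy
    refine Finset.sum_subset (Finset.subset_univ X) fun k _ hk => ?_
    have hne : orb y σ ≠ orb k σ := fun h' => hk ((orb_inj.1 h').1 ▸ hy)
    rw [anticommutator_commutator_creation_eq_zero hA hk hne, Matrix.mul_zero, Matrix.trace_zero, mul_zero]
  rw [Finset.sum_congr rfl hinner]
  refine Finset.sum_subset (Finset.subset_univ X) fun y _ hy => ?_
  refine Finset.sum_eq_zero fun k _ => ?_
  rw [commutator_eq_zero_of_not_mem hA hy σ, Matrix.zero_mul, Matrix.mul_zero, add_zero, Matrix.mul_zero, Matrix.trace_zero,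
    mul_zero]

/-! ## §3 The insertion has norm at most `4‖A‖` -/

/-- `‖{[c_{yσ},A], c†_{kτ}}‖ ≤ 4‖A‖`. -/
theorem norm_anticommutator_commutator_creation_le (A : Matrix (Finset (Orb Λ)) (Finset (Orb Λ)) ℂ) (q p : Orb Λ) :
    ‖(annihilation q * A - A * annihilation q) * creation p + creation p * (annihilation q * A - A * annihilation q)‖ ≤ 4 * ‖A‖ := by
  have h1 := norm_commutator_mul_creation_le A q p
  have hc := norm_creation_le_one (ι := Orb Λ) p
  have hcomm : ‖annihilation q * A - A * annihilation q‖ ≤ 2 * ‖A‖ := by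
    have ha := norm_annihilation_le_one (ι := Orb Λ) q
    have hA := norm_nonneg A
    refine (norm_sub_le _ _).trans ?_
    have e1 : ‖annihilation q * A‖ ≤ ‖A‖ := (norm_mul_le _ _).trans (by nlinarith [norm_nonneg (annihilation q : Matrix _ _ ℂ)])
    have e2 : ‖A * annihilation q‖ ≤ ‖A‖ := (norm_mul_le _ _).trans (by nlinarith [norm_nonneg (annihilation q : Matrix _ _ ℂ)])
    linarith
  have h2 : ‖creation p * (annihilation q * A - A * annihilation q)‖ ≤ 2 * ‖A‖ := by
    refine (norm_mul_le _ _).trans ?_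
    calc ‖(creation p : Matrix (Finset (Orb Λ)) (Finset (Orb Λ)) ℂ)‖ * ‖annihilation q * A - A * annihilation q‖
        ≤ 1 * (2 * ‖A‖) := mul_le_mul hc hcomm (norm_nonneg _) (by norm_num)
      _ = 2 * ‖A‖ := one_mul _
  refine (norm_add_le _ _).trans ?_
  linarith

end Summit.Ventures.CertifiedManyBodySolver.Theorems.TcThermcert1.FreeCanonicalB8

end
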